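import Mathlib
import Summits.Ventures.PercRepro2.Defs
import Summits.Ventures.PercRepro2.Independence
import Summits.Ventures.PercRepro2.Harris
import Summits.Ventures.PercRepro2.Graph
import Summits.Ventures.PercRepro2.Exploration
import Summits.Ventures.PercRepro2.Events
import Summits.Ventures.PercRepro2.Statements
import Summits.Ventures.PercRepro2.FourFunctions
import Summits.Ventures.PercRepro2.Induced
import Summits.Ventures.PercRepro2.Frontier
import Summits.Ventures.PercRepro2.ObsIndependence
import Summits.Ventures.PercRepro2.BHK
import Summits.Ventures.PercRepro2.BHKEvents
import Summits.Ventures.PercRepro2.OrderPreservation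
import Summits.Ventures.PercRepro2.VdBKahn
import Summits.Ventures.PercRepro2.KNTwo
import Summits.Ventures.PercRepro2.BHKAvoid
import Summits.Ventures.PercRepro2.R4Defs
import Summits.Ventures.PercRepro2.R4Plus
import Summits.Ventures.PercRepro2.R4Ladder

/-!
# The `|A| = 2` ladder: proved rungs (blind cell PercRepro2, p1)

On typer-1's `R4Ladder.lean` statements: `t2Nonneg : T2Nonneg` (rung (i)), the order hypothesis
in its cluster form (`connOrder_iff`), `h2_of_h2Prime` ((H2′) ⟹ (H2) under the order) and
`r4PlusTwoOrdered_of_h2PrimeOrdered` ((H2′) ⟹ R4+ at `|A| = 2`). The open rung is (H2′) itself.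
-/

namespace Summit.Ventures.PercRepro2

section LadderProofs

variable {V : Type*} {E : Type*} [Fintype E] [DecidableEq E] [Fintype V] [DecidableEq V]
  {R : Type*} [Field R] [LinearOrder R] [IsStrictOrderedRing R]

omit [Fintype V] in
/-- The order hypothesis in cluster form: `P(a₁ ↔ b) ≤ P(a₂ ↔ b)` iff
`P(a₁ ↔ b, a₁ ↮ a₂) ≤ P(a₂ ↔ b, a₂ ↮ a₁)` (the common part `a₁ ↔ a₂ ↔ b` cancels). -/
lemma connOrder_iff (p : E → R) (ends : E → Sym2 V) (a₁ a₂ b : V) :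
    ConnOrder p ends a₁ a₂ b ↔
      prob p (connEvent ends a₁ b ∩ avoidAll ends a₂ {a₁, b}) ≤
        prob p (connEvent ends a₂ b ∩ (connEvent ends a₂ a₁)ᶜ) := by
  unfold ConnOrder
  have h1 := prob_inter_add_prob_inter_compl p (connEvent ends a₁ b) (connEvent ends a₁ a₂)
  have h2 := prob_inter_add_prob_inter_compl p (connEvent ends a₂ b) (connEvent ends a₂ a₁)
  have e : connEvent ends a₁ b ∩ connEvent ends a₁ a₂ = connEvent ends a₂ b ∩ connEvent ends a₂ a₁ := by
    ext ω
    simp only [Set.mem_inter_iff, mem_connEvent]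
    constructor
    · rintro ⟨h1, h2⟩; exact ⟨conn_trans (conn_symm h2) h1, conn_symm h2⟩
    · rintro ⟨h1, h2⟩; exact ⟨conn_trans (conn_symm h2) h1, conn_symm h2⟩
  rw [e] at h1
  rw [connEvent_inter_avoidAll_eq]
  constructor <;> intro h <;> linarith

/-- **Rung (i)**: `T2Nonneg` (typer-1's statement) holds. -/
theorem t2Nonneg (p : E → R) (hp : IsProbVec p) (ends : E → Sym2 V) (o a₁ a₂ b : V) :
    T2Nonneg p ends o a₁ a₂ b :=
  fun h => t2_nonneg p hp ends o a₁ a₂ b h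

/-- **(H2′) ⟹ (H2)** under the order hypothesis: `ρ₀ ≤ P(b ∈ U, a₁ ∉ U)/P(a₁, b ∉ U)` is exactly the
order, so `ρ₀ · P(o ∈ U, a₁, b ∉ U) ≤ P(o ∈ U, a₁, b ∉ U) · P(b ∈ U, a₁ ∉ U)/P(a₁, b ∉ U)`. -/
theorem h2_of_h2Prime (p : E → R) (hp : IsProbVec p) (ends : E → Sym2 V) (o a₁ a₂ b : V)
    (hord : ConnOrder p ends a₁ a₂ b) (h : H2Prime p ends o a₁ a₂ b) : H2 p ends o a₁ a₂ b := by
  unfold H2Prime pax at h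
  unfold H2 rhoZero
  have hr := (connOrder_iff p ends a₁ a₂ b).1 hord
  have hy : 0 ≤ prob p (connEvent ends o a₂ ∩ avoidAll ends a₂ {a₁, b}) := prob_nonneg hp _
  have hg : 0 ≤ prob p (avoidAll ends a₂ {a₁, b}) := prob_nonneg hp _
  rcases hg.lt_or_eq with hg0 | hg0
  · have : prob p (connEvent ends a₁ b ∩ avoidAll ends a₂ {a₁, b}) / prob p (avoidAll ends a₂ {a₁, b}) *
        prob p (connEvent ends o a₂ ∩ avoidAll ends a₂ {a₁, b}) ≤
        prob p (connEvent ends o a₂ ∩ avoidAll ends a₂ {a₁, b}) *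
          prob p (connEvent ends a₂ b ∩ (connEvent ends a₂ a₁)ᶜ) / prob p (avoidAll ends a₂ {a₁, b}) := by
      rw [div_mul_eq_mul_div, div_le_div_iff_of_pos_right hg0]
      nlinarith [hr, hy]
    linarith
  · rw [← hg0, div_zero, zero_mul, zero_add]
    rw [← hg0, div_zero, sub_zero] at h
    exact h

/-- **(H2′)_ordered ⟹ R4+ at `|A| = 2` ordered**. -/
theorem r4PlusTwoOrdered_of_h2PrimeOrdered (p : E → R) (hp : IsProbVec p) (ends : E → Sym2 V)
    (o a₁ a₂ b : V) (h : H2PrimeOrdered p ends o a₁ a₂ b) : R4PlusTwoOrdered p ends o a₁ a₂ b :=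
  fun hord => r4PlusTwo_of_H2 p hp ends (h2_of_h2Prime p hp ends o a₁ a₂ b hord (h hord))

/-- **(H2)_ordered ⟹ R4+ at `|A| = 2` ordered**. -/
theorem r4PlusTwoOrdered_of_h2Ordered (p : E → R) (hp : IsProbVec p) (ends : E → Sym2 V)
    (o a₁ a₂ b : V) (h : H2Ordered p ends o a₁ a₂ b) : R4PlusTwoOrdered p ends o a₁ a₂ b :=
  fun hord => r4PlusTwo_of_H2 p hp ends (h hord)

end LadderProofs

section LadderClosures

variable (R : Type) [Field R] [LinearOrder R] [IsStrictOrderedRing R]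

/-- `H2PrimeOrdered_all R → R4PlusTwoOrdered_all R`. -/
theorem r4PlusTwoOrdered_all_of_h2PrimeOrdered_all (h : H2PrimeOrdered_all R) :
    R4PlusTwoOrdered_all R := by
  intro V E _ _ _ _ ends p hp o a₁ a₂ b h1 h2 h3 h4
  exact r4PlusTwoOrdered_of_h2PrimeOrdered p hp ends o a₁ a₂ b (h V E ends p hp o a₁ a₂ b h1 h2 h3 h4)

/-- `H2Ordered_all R → R4PlusTwoOrdered_all R`. -/
theorem r4PlusTwoOrdered_all_of_h2Ordered_all (h : H2Ordered_all R) : R4PlusTwoOrdered_all R := by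
  intro V E _ _ _ _ ends p hp o a₁ a₂ b h1 h2 h3 h4
  exact r4PlusTwoOrdered_of_h2Ordered p hp ends o a₁ a₂ b (h V E ends p hp o a₁ a₂ b h1 h2 h3 h4)

end LadderClosures

end Summit.Ventures.PercRepro2
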